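import Summits.CriticalPhenomena.Ising3DConformalLimit.Theorems.ArmHyperscalingOneArmHyperscalingMirrorFaceDefs
import Literature.Probability.LatticeModels.IsingAutomorphismCovariance
import Literature.Probability.Percolation.SiteConnectionTools
import HarnessLib

/-!
# Lattice symmetry of the six face terms
(route ArmHyperscaling, crux `OneArmHyperscaling`, item stmt-CriticalPhenomena-15591, line
`mirror-face-saturation`, registered stub `stub_faceSymmetry : FaceSymmetry`)

Statement (`stub_faceSymmetry`, literally the line's `def FaceSymmetry : Prop` of the definitions
module `Theorems/ArmHyperscalingOneArmHyperscalingMirrorFaceDefs.lean`): for all `K n L : ℕ` and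
each of the six exterior faces `face K n i` (`i : Fin 6`) of the translated plus box
`x_n + Λ_{Kn}`, `x_n = evalSite n = n e₀`,
`⟨σ_{x_n}⟩⁺_{Λ_L ∖ face K n i; β_c, 0} = ⟨σ_{x_n}⟩⁺_{(Λ_L + faceShift n i) ∖ facePatch K n; β_c, 0}`,
i.e. `frozenMag n L (face K n i) = frozenMagShift n L (faceShift n i) (facePatch K n)`.

Proof.  For each `i` there is a lattice isometry `g_i` of `ℤ³` — a signed coordinate permutation
followed by the translation `faceShift n i` (tree `zdSignedPermIso`, `zdShiftIso`) — which FIXES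
`x_n`, maps the centred box `Λ_L` onto `Λ_L + faceShift n i` (signed permutations preserve centred
boxes, tree `signedPerm_mem_box_iff`) and maps `face K n i` onto `facePatch K n` (linear integer
arithmetic on coordinates):
`g₀ = id`, `g₁ y = (2n − y₀, y₁, y₂)`, `g₂ y = (y₁ + n, y₀ − n, y₂)`, `g₃ y = (n − y₁, y₀ − n, y₂)`,
`g₄ y = (y₂ + n, y₁, y₀ − n)`, `g₅ y = (n − y₂, y₁, y₀ − n)`.
The covariance of the fixed-boundary finite-volume expectations under graph automorphisms
(tree `isingExpect_fixed_relabel`: `⟨F⟩^{R_φ η}_{φ(Λ)} = ⟨F ∘ R_φ⟩^{η}_{Λ}`; Friedli–Velenik 2017,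
§3.1 and Exercise 6.21; Georgii–Higuchi 2000, §2 p. 3), applied with `φ = g_i`,
`Λ = Λ_L ∖ face K n i`, the invariant constant boundary condition `η ≡ +1` (`R_φ 1 = 1`) and the
observable `F = σ_{x_n}` (`σ_{x_n} ∘ R_φ = σ_{φ⁻¹ x_n} = σ_{x_n}`), gives the claim, since
`φ(Λ_L ∖ face K n i) = φ(Λ_L) ∖ φ(face K n i) = (Λ_L + faceShift n i) ∖ facePatch K n`.

References: S. Friedli, Y. Velenik, *Statistical Mechanics of Lattice Systems* (CUP 2017), §3.1,
Exercise 6.21 (invariance of the Ising specification under lattice symmetries); H.-O. Georgii,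
Y. Higuchi, J. Math. Phys. 41 (2000) 1153–1169, §2 p. 3.  No definitions are introduced; the six
isometries are written inline as `(zdSignedPermIso π ε).trans (zdShiftIso (faceShift n i))`.
-/

noncomputable section

namespace Summit.CriticalPhenomena.Ising3DConformalLimit.Cruxes.OneArmHyperscaling.MirrorFaceSaturation

open Literature.Probability.LatticeModels Literature.Probability.Percolation Finset

/-- **Plus magnetisation at a fixed point of a lattice automorphism**: if the graph automorphism
`φ` of `ℤ³` fixes `x`, then `⟨σ_x⟩⁺_{φ(Λ); β, h} = ⟨σ_x⟩⁺_{Λ; β, h}` for every finite volume `Λ`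
(covariance `isingExpect_fixed_relabel` with the invariant boundary condition `R_φ 1 = 1` and
`σ_x ∘ R_φ = σ_{φ⁻¹ x} = σ_x`; Friedli–Velenik 2017, §3.1, Exercise 6.21).
[cite: FriedliVelenik2017, §3.1] -/
private theorem isingExpect_plus_spinAt_map (φ : zdGraph 3 ≃g zdGraph 3) (Λ : Finset (Site 3))
    (β h : ℝ) {x : Site 3} (hx : φ x = x) :
    isingExpect (zdGraph 3) (Λ.map φ.toEquiv.toEmbedding) β h .plus (spinAt x) =
      isingExpect (zdGraph 3) Λ β h .plus (spinAt x) := by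
  have key := isingExpect_fixed_relabel (zdGraph 3) φ Λ β h 1 (measurable_spinAt x)
  have hc : configRelabel φ.toEquiv (1 : SpinConfig (Site 3)) = 1 := funext fun y => by simp
  have hF : (spinAt x ∘ (configRelabel φ.toEquiv)) = spinAt x := by
    funext σ
    rw [Function.comp_apply]
    conv_lhs => rw [← hx]
    exact spinAt_apply_configRelabel φ.toEquiv σ x
  rw [hc, hF] at key
  exact key

/-- The isometry `signed permutation (π, ε)` followed by `translation by v` acts as
`x ↦ signedPerm π ε x + v`. [folklore] -/
private theorem frame_apply (π : Equiv.Perm (Fin 3)) (ε : Fin 3 → ℤˣ) (v x : Site 3) :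
    ((zdSignedPermIso π ε).trans (zdShiftIso v)) x = Site.signedPerm π ε x + v := rfl

/-- Coordinates of the inverse isometry: `(g⁻¹ y)_j = ε_{π j} (y_{π j} − v_{π j})`. [folklore] -/
private theorem frame_symm_apply (π : Equiv.Perm (Fin 3)) (ε : Fin 3 → ℤˣ) (v y : Site 3) :
    ((zdSignedPermIso π ε).trans (zdShiftIso v)).toEquiv.symm y =
      fun j => (ε (π j) : ℤ) * (y (π j) - v (π j)) := by
  funext j
  change (Site.signedPerm π ε).symm ((Site.shift v).symm y) j = _
  rw [Site.signedPerm_symm_apply, Site.shift_symm_apply, Pi.sub_apply]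

/-- The isometry `y ↦ signedPerm π ε y + v` maps the centred box `Λ_L` onto `Λ_L + v` (signed
permutations preserve centred boxes, `signedPerm_mem_box_iff`). [folklore] -/
private theorem box_map_frame (π : Equiv.Perm (Fin 3)) (ε : Fin 3 → ℤˣ) (v : Site 3) (L : ℕ) :
    (box 3 L).map ((zdSignedPermIso π ε).trans (zdShiftIso v)).toEquiv.toEmbedding =
      (box 3 L).map (Site.shift v).toEmbedding := by
  ext y
  rw [Finset.mem_map_equiv, Finset.mem_map_equiv]
  change (Site.signedPerm π ε).symm ((Site.shift v).symm y) ∈ box 3 L ↔ _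
  rw [Site.signedPerm_symm, signedPerm_mem_box_iff]

/-- Membership in a coordinate-box `piFinset` of `ℤ³`, coordinate by coordinate. [folklore] -/
private theorem mem_piFinset_fin3 {S : Fin 3 → Finset ℤ} {y : Site 3} :
    y ∈ Fintype.piFinset S ↔ y 0 ∈ S 0 ∧ y 1 ∈ S 1 ∧ y 2 ∈ S 2 := by
  rw [Fintype.mem_piFinset, Fin.forall_fin_succ, Fin.forall_fin_two]
  rfl

/-- **One face term by one isometry.**  If the isometry `g = (signed permutation (π, ε)) + faceShift n i`
fixes `x_n` and pulls `face K n i` back exactly onto `facePatch K n` (`g⁻¹ y ∈ face K n i ↔ y ∈ facePatch K n`),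
then `⟨σ_{x_n}⟩⁺_{Λ_L ∖ face K n i} = ⟨σ_{x_n}⟩⁺_{(Λ_L + faceShift n i) ∖ facePatch K n}`: `g` maps
`Λ_L` onto `Λ_L + faceShift n i` (`box_map_frame`), images of embeddings commute with set difference
(`Finset.map_sdiff`), and the plus expectation of `σ_{x_n}` is `g`-covariant
(`isingExpect_plus_spinAt_map`; Friedli–Velenik 2017, §3.1, Exercise 6.21). [cite: FriedliVelenik2017, §3.1] -/
private theorem frozenMag_eq_of_frame (K n L : ℕ) (i : Fin 6) (π : Equiv.Perm (Fin 3))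
    (ε : Fin 3 → ℤˣ) (hfix : Site.signedPerm π ε (evalSite n) + faceShift n i = evalSite n)
    (hface : ∀ y : Site 3,
      (fun j => (ε (π j) : ℤ) * (y (π j) - faceShift n i (π j))) ∈ face K n i ↔ y ∈ facePatch K n) :
    frozenMag n L (face K n i) = frozenMagShift n L (faceShift n i) (facePatch K n) := by
  set φ : zdGraph 3 ≃g zdGraph 3 := (zdSignedPermIso π ε).trans (zdShiftIso (faceShift n i))
    with hφ
  have hx : φ (evalSite n) = evalSite n := by rw [hφ, frame_apply]; exact hfix
  have hbox : (box 3 L).map φ.toEquiv.toEmbedding =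
      (box 3 L).map (Site.shift (faceShift n i)).toEmbedding := box_map_frame π ε _ L
  have hfc : (face K n i).map φ.toEquiv.toEmbedding = facePatch K n := by
    ext y
    rw [Finset.mem_map_equiv, hφ, frame_symm_apply]
    exact hface y
  unfold frozenMag frozenMagShift
  rw [← hbox, ← hfc, ← Finset.map_sdiff]
  exact (isingExpect_plus_spinAt_map φ _ _ _ hx).symm

/-- **`FaceSymmetry`** (registered stub `stub_faceSymmetry` of the line `mirror-face-saturation`,
crux `OneArmHyperscaling`, item stmt-CriticalPhenomena-15591): for every `K n L` and each of the six
exterior faces of the translated plus box `x_n + Λ_{Kn}`,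
`⟨σ_{x_n}⟩⁺_{Λ_L ∖ face K n i; β_c(3), 0} = ⟨σ_{x_n}⟩⁺_{(Λ_L + faceShift n i) ∖ facePatch K n; β_c(3), 0}`.
Six instances of `frozenMag_eq_of_frame` with the isometries `g₀ = id`, `g₁ y = (2n − y₀, y₁, y₂)`,
`g₂ y = (y₁ + n, y₀ − n, y₂)`, `g₃ y = (n − y₁, y₀ − n, y₂)`, `g₄ y = (y₂ + n, y₁, y₀ − n)`,
`g₅ y = (n − y₂, y₁, y₀ − n)` (as `signedPerm π ε + faceShift n i` with `π ∈ {1, (0 1), (0 2)}`,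
`ε ∈ {1, (−1, 1, 1)}`); the two geometric side conditions are linear integer arithmetic on
coordinates (covariance of the finite-volume Gibbs measures under lattice symmetries,
Friedli–Velenik 2017, §3.1, Exercise 6.21; Georgii–Higuchi 2000, §2 p. 3). [cite: FriedliVelenik2017, §3.1] -/
theorem stub_faceSymmetry : MirrorFaceSaturation.FaceSymmetry := by
  intro K n L i
  match i with
  | 0 =>
    refine frozenMag_eq_of_frame K n L 0 (Equiv.refl _) 1 ?_ fun y => ?_
    · funext j; fin_cases j <;> simp [evalSite, faceShift]
    · simp only [face, facePatch, mem_piFinset_fin3, faceShift]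
      simp
  | 1 =>
    refine frozenMag_eq_of_frame K n L 1 (Equiv.refl _) ![-1, 1, 1] ?_ fun y => ?_
    · funext j; fin_cases j <;> simp [evalSite, faceShift]
      omega
    · simp only [face, facePatch, mem_piFinset_fin3, faceShift]
      simp [Finset.mem_Icc]
      omega
  | 2 =>
    refine frozenMag_eq_of_frame K n L 2 (Equiv.swap 0 1) 1 ?_ fun y => ?_
    · funext j; fin_cases j <;> simp [evalSite, faceShift, Equiv.swap_apply_def]
    · simp only [face, facePatch, mem_piFinset_fin3, faceShift]
      simp [Equiv.swap_apply_def, Finset.mem_Icc]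
      omega
  | 3 =>
    refine frozenMag_eq_of_frame K n L 3 (Equiv.swap 0 1) ![-1, 1, 1] ?_ fun y => ?_
    · funext j; fin_cases j <;> simp [evalSite, faceShift, Equiv.swap_apply_def]
    · simp only [face, facePatch, mem_piFinset_fin3, faceShift]
      simp [Equiv.swap_apply_def, Finset.mem_Icc]
      omega
  | 4 =>
    refine frozenMag_eq_of_frame K n L 4 (Equiv.swap 0 2) 1 ?_ fun y => ?_
    · funext j; fin_cases j <;> simp [evalSite, faceShift, Equiv.swap_apply_def]
    · simp only [face, facePatch, mem_piFinset_fin3, faceShift]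
      simp [Equiv.swap_apply_def, Finset.mem_Icc]
      omega
  | 5 =>
    refine frozenMag_eq_of_frame K n L 5 (Equiv.swap 0 2) ![-1, 1, 1] ?_ fun y => ?_
    · funext j; fin_cases j <;> simp [evalSite, faceShift, Equiv.swap_apply_def]
    · simp only [face, facePatch, mem_piFinset_fin3, faceShift]
      simp [Equiv.swap_apply_def, Finset.mem_Icc]
      omega

end Summit.CriticalPhenomena.Ising3DConformalLimit.Cruxes.OneArmHyperscaling.MirrorFaceSaturation

end
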